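import Summits.CriticalPhenomena.SAWScalingLimit.Theorems.SAWDevelopingMapObservableToSLETypeLadderCarvedReductionSqueezeCorridor
import HarnessLib

/-!
# The reach disc: the closed `25 s`-disc about a present pinned vertex lies in the super-domain up
# to the gate slabs (piece (T-A′ P4-disc) of stub T-A′ `stub_carvedReduction_squeezeGeometry_domains`)

Crux `SAWDevelopingMap.ObservableToSLE` (stmt-CriticalPhenomena-10472), line `six-class-type-ladder`,
stub T-A′ `stub_carvedReduction_squeezeGeometry_domains`.  Landing target:
`Summits/CriticalPhenomena/SAWScalingLimit/Theorems/SAWDevelopingMapObservableToSLETypeLadderCarvedReductionSqueezeReachDisc.lean`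
(`--supports stmt-CriticalPhenomena-10472`; registered carrier `stub_carvedReduction_reachDisc`).

Clause (R) of STAGE 2 (`carvedReduction_squeezeGeometry_lattice`, p137080) asks, for every vertex
`y` of a removed-set-avoiding walk from the gate, that its pinned centre `ỹ` lie in `E` and that
`closedBall ỹ (25 s) ⊆ E ∪ ⋃ᵢ slabᵢ`, `slabᵢ = {|re - re Pᵢ| ≤ ρc, im Pᵢ - 30 s ≤ im ≤ im Pᵢ}`.
For the framed super-domain `E` (every point joined to the bulk point `b₀` inside `J` off the cuts
lies in `E`, `stub_carvedReduction_superFrame`) this is pure plane geometry at a fixed level, given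
(from `stub_carvedReduction_walkOffZones`, `κ = 60`) that every point within `60 s` of `ỹ` is in
`J` and off the FAR obstacles `Y` (exit zones, body zones), that `ỹ` is joined to `b₀` off the
cuts, that `ỹ` lies strictly above the gate line when inside a window `ball (P i) R₁`
(`gate_present_above`), and that the cuts inside `J` lie in `Y` or in the NEAR obstacles of the
two gates: the closed frame rectangles `Rᵢ = [re Pᵢ ± ρc] × [im Pᵢ - h, im Pᵢ]` and the deep low
boxes `{im < im Pᵢ - h} ∩ ball (P i) (R₁ - μ)`.  `stub_carvedReduction_reachDisc`: then every point
`p` of `closedBall ỹ (25 s)` is in `E` or in a slab — join `p` to `ỹ` by the straight segment (far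
from the windows) or by the path `ỹ → (re p, im ỹ) → p` (horizontal above the line, then
vertical; it meets `Rᵢ` only if `|re p - re Pᵢ| ≤ ρc` and `im p ≤ im Pᵢ`, i.e. `p ∈ slabᵢ`).
-/

noncomputable section
open Set Metric
open Literature.Probability.RandomPlanarGeometry

namespace Summit.CriticalPhenomena.SAWScalingLimit.Theorems.ObservableToSLE.TypeLadder

/-- Points of a horizontal segment have the common height and abscissa between the endpoints'. -/
theorem im_eq_of_mem_hSegment' {a b p : ℂ} (hab : a.im = b.im) (hp : p ∈ segment ℝ a b) :
    p.im = a.im ∧ min a.re b.re ≤ p.re ∧ p.re ≤ max a.re b.re := by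
  rw [segment_eq_image'] at hp
  obtain ⟨θ, hθ, rfl⟩ := hp
  refine ⟨by simp [hab], ?_, ?_⟩
  · simp only [Complex.add_re, Complex.real_smul, Complex.mul_re, Complex.ofReal_re, Complex.sub_re,
      Complex.ofReal_im, Complex.sub_im, zero_mul, sub_zero]
    rcases le_total a.re b.re with h | h
    · rw [min_eq_left h]; nlinarith [hθ.1]
    · rw [min_eq_right h]; nlinarith [hθ.2]
  · simp only [Complex.add_re, Complex.real_smul, Complex.mul_re, Complex.ofReal_re, Complex.sub_re,
      Complex.ofReal_im, Complex.sub_im, zero_mul, sub_zero]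
    rcases le_total a.re b.re with h | h
    · rw [max_eq_right h]; nlinarith [hθ.2]
    · rw [max_eq_left h]; nlinarith [hθ.1]

/-- Points of a vertical segment have the common abscissa and height between the endpoints'. -/
theorem re_eq_of_mem_vSegment' {a b p : ℂ} (hab : a.re = b.re) (hp : p ∈ segment ℝ a b) :
    p.re = a.re ∧ min a.im b.im ≤ p.im ∧ p.im ≤ max a.im b.im := by
  rw [segment_eq_image'] at hp
  obtain ⟨θ, hθ, rfl⟩ := hp
  refine ⟨by simp [hab], ?_, ?_⟩
  · simp only [Complex.add_im, Complex.real_smul, Complex.mul_im, Complex.ofReal_re, Complex.sub_im,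
      Complex.ofReal_im, Complex.sub_re, zero_mul, add_zero]
    rcases le_total a.im b.im with h | h
    · rw [min_eq_left h]; nlinarith [hθ.1]
    · rw [min_eq_right h]; nlinarith [hθ.2]
  · simp only [Complex.add_im, Complex.real_smul, Complex.mul_im, Complex.ofReal_re, Complex.sub_im,
      Complex.ofReal_im, Complex.sub_re, zero_mul, add_zero]
    rcases le_total a.im b.im with h | h
    · rw [max_eq_right h]; nlinarith [hθ.2]
    · rw [max_eq_left h]; nlinarith [hθ.1]

/-- **Registered carrier `stub_carvedReduction_reachDisc`** (crux item stmt-CriticalPhenomena-10472,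
stub T-A′ `stub_carvedReduction_squeezeGeometry_domains`, piece THE REACH DISC); see the module
docstring.  Constants: `0 < s`, `25 s < h`, `50 s < μ`, `0 < ρc`, `ρc + h + μ < R₁`,
`2 R₁ + 60 s ≤ dist (P 0) (P 1)`. -/
theorem stub_carvedReduction_reachDisc :
    ∀ (J E Cut Y : Set ℂ) (P : Fin 2 → ℂ) (b₀ y : ℂ) (s ρc h R₁ μ : ℝ),
      0 < s → 25 * s < h → 50 * s < μ → 0 < ρc → ρc + h + μ < R₁ → 2 * R₁ + 60 * s ≤ dist (P 0) (P 1) →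
      (∀ z : ℂ, JoinedIn (J \ Cut) z b₀ → z ∈ E) →
      Cut ∩ J ⊆ Y ∪ ⋃ i, ({z : ℂ | |z.re - (P i).re| ≤ ρc ∧ (P i).im - h ≤ z.im ∧ z.im ≤ (P i).im} ∪
        ({z : ℂ | z.im < (P i).im - h} ∩ ball (P i) (R₁ - μ))) →
      (∀ p : ℂ, dist p y ≤ 60 * s → p ∈ J ∧ p ∉ Y) →
      JoinedIn (J \ Cut) y b₀ →
      (∀ i, dist y (P i) < R₁ → (P i).im < y.im) →
      y ∈ E ∧ ∀ p ∈ closedBall y (25 * s), p ∈ E ∨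
        ∃ i, |p.re - (P i).re| ≤ ρc ∧ (P i).im - 30 * s ≤ p.im ∧ p.im ≤ (P i).im := by
  intro J E Cut Y P b₀ y s ρc h R₁ μ hs hsh hsμ hρc hR₁ hsep hjoinE hCut hpt hy habove
  -- points of a segment are within its length of its first endpoint
  -- (`Literature.Probability.Percolation.dist_left_le_dist_of_mem_segment`, re-proved inline)
  have dist_le_of_mem_segment : ∀ {a b p : ℂ}, p ∈ segment ℝ a b → dist p a ≤ dist a b := fun {a b p} hp => by
    have := (convex_closedBall a (dist a b)).segment_subset (mem_closedBall_self dist_nonneg)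
      (mem_closedBall.2 (by rw [dist_comm])) hp
    exact mem_closedBall.1 this
  -- notation: the near obstacles
  set N : Fin 2 → Set ℂ := fun i =>
    {z : ℂ | |z.re - (P i).re| ≤ ρc ∧ (P i).im - h ≤ z.im ∧ z.im ≤ (P i).im} ∪
      ({z : ℂ | z.im < (P i).im - h} ∩ ball (P i) (R₁ - μ)) with hN
  have hNball : ∀ i, N i ⊆ ball (P i) (R₁ - μ) := by
    rintro i z (⟨hre, him1, him2⟩ | ⟨-, hz⟩)
    · rw [mem_ball]
      refine (dist_le_abs_re_add_abs_im z (P i)).trans_lt ?_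
      rw [Complex.sub_re, Complex.sub_im]
      have : |z.im - (P i).im| ≤ h := by rw [abs_le]; constructor <;> linarith
      linarith
    · exact hz
  -- a point of `J` off `Y` and off both `N i` is off the cuts
  have hoff : ∀ p : ℂ, p ∈ J → p ∉ Y → (∀ i, p ∉ N i) → p ∈ J \ Cut := by
    intro p hpJ hpY hpN
    refine ⟨hpJ, fun hpC => ?_⟩
    rcases hCut ⟨hpC, hpJ⟩ with h1 | h1
    · exact hpY h1
    · obtain ⟨i, hi⟩ := mem_iUnion.1 h1
      exact hpN i hi
  refine ⟨hjoinE y hy, fun p hp => ?_⟩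
  have hp25 : dist p y ≤ 25 * s := mem_closedBall.1 hp
  -- is `y` inside a window?
  by_cases hwin : ∃ i, dist y (P i) < R₁
  · obtain ⟨i, hi⟩ := hwin
    have hyim : (P i).im < y.im := habove i hi
    -- the other gate is far from everything within `60 s` of `y`
    have hfar : ∀ p' : ℂ, dist p' y ≤ 60 * s → ∀ k, k ≠ i → p' ∉ N k := by
      intro p' hp' k hki hp'N
      have h1 := mem_ball.1 (hNball k hp'N)
      have hPik : dist (P i) (P k) = dist (P 0) (P 1) := by
        fin_cases i <;> fin_cases k
        · exact absurd rfl hki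
        · rfl
        · exact dist_comm _ _
        · exact absurd rfl hki
      have h2 := dist_triangle4 (P i) y p' (P k)
      rw [hPik, dist_comm (P i) y, dist_comm y p'] at h2
      have hμ0 : 0 < μ := by linarith
      linarith
    -- the slab case
    by_cases hslab : |p.re - (P i).re| ≤ ρc ∧ p.im ≤ (P i).im
    · right
      refine ⟨i, hslab.1, ?_, hslab.2⟩
      have h1 : |(p - y).im| ≤ 25 * s := (Complex.abs_im_le_norm (p - y)).trans (by rw [← dist_eq_norm]; exact hp25)
      rw [Complex.sub_im, abs_le] at h1
      linarith [h1.1]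
    · -- the two-segment path `y → c → p`, `c = (re p, im y)`
      left
      set c : ℂ := ⟨p.re, y.im⟩ with hc
      have hpre : |p.re - y.re| ≤ 25 * s := by
        have := Complex.abs_re_le_norm (p - y); rw [Complex.sub_re, ← dist_eq_norm] at this; linarith
      have hpim : |p.im - y.im| ≤ 25 * s := by
        have := Complex.abs_im_le_norm (p - y); rw [Complex.sub_im, ← dist_eq_norm] at this; linarith
      have hcy : dist c y ≤ 25 * s := by
        rw [dist_eq_norm]
        have : c - y = ((p.re - y.re : ℝ) : ℂ) := by apply Complex.ext <;> simp [hc]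
        rw [this, Complex.norm_real, Real.norm_eq_abs]; exact hpre
      have hcp : dist c p ≤ 25 * s := by
        rw [dist_eq_norm]
        have : c - p = ((y.im - p.im : ℝ) : ℂ) * Complex.I := by apply Complex.ext <;> simp [hc]
        rw [this, norm_mul, Complex.norm_I, mul_one, Complex.norm_real, Real.norm_eq_abs, abs_sub_comm]; exact hpim
      -- horizontal segment `[y, c]`: height `im y > im P i`
      have hseg1 : segment ℝ y c ⊆ J \ Cut := by
        intro p' hp'
        have hd : dist p' y ≤ 60 * s := (dist_le_of_mem_segment hp').trans (by rw [dist_comm]; linarith)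
        obtain ⟨hJ', hY'⟩ := hpt p' hd
        refine hoff p' hJ' hY' fun k => ?_
        by_cases hki : k = i
        · subst hki
          obtain ⟨him', -, -⟩ := im_eq_of_mem_hSegment' (show y.im = c.im by simp [hc]) hp'
          rintro (⟨-, -, h2⟩ | ⟨h2, -⟩)
          · rw [him'] at h2; linarith
          · have h3 : p'.im < (P k).im - h := h2
            rw [him'] at h3; linarith
        · exact hfar p' hd k hki
      -- vertical segment `[c, p]`: abscissa `re p`
      have hseg2 : segment ℝ c p ⊆ J \ Cut := by
        intro p' hp'
        have hd' : dist p' c ≤ 25 * s := (dist_le_of_mem_segment hp').trans hcp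
        have hd : dist p' y ≤ 60 * s := by linarith [dist_triangle p' c y]
        obtain ⟨hJ', hY'⟩ := hpt p' hd
        refine hoff p' hJ' hY' fun k => ?_
        by_cases hki : k = i
        · subst hki
          obtain ⟨hre', him1, -⟩ := re_eq_of_mem_vSegment' (show c.re = p.re by simp [hc]) hp'
          have hcim : c.im = y.im := by simp [hc]
          have hlow : y.im - 25 * s ≤ p'.im := by
            have h1 : y.im - 25 * s ≤ min c.im p.im := le_min (by rw [hcim]; linarith) (by
              have := abs_le.1 hpim; linarith [this.1])
            exact h1.trans him1
          rintro (⟨h1, -, h3⟩ | ⟨h2, -⟩)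
          · -- in the rectangle: then `|re p - re P| ≤ ρc` and `im p ≤ im P`, the slab case
            rw [hre', show c.re = p.re by simp [hc]] at h1
            refine hslab ⟨h1, ?_⟩
            -- `p` is the lower endpoint unless `p` is above `c`, but then `p' = ` … compare heights
            by_contra hpP
            push Not at hpP
            -- both endpoints of `[c, p]` are above the line, so is `p'`
            have : (P k).im < min c.im p.im := lt_min (by rw [hcim]; exact hyim) hpP
            linarith [him1]
          · have h3 : p'.im < (P k).im - h := h2
            linarith
        · exact hfar p' hd k hki
      have hpath : JoinedIn (J \ Cut) y p := (JoinedIn.of_segment_subset hseg1).trans (JoinedIn.of_segment_subset hseg2)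
      exact hjoinE p (hpath.symm.trans hy)
  · -- far from both windows: the straight segment
    left
    push Not at hwin
    have hseg : segment ℝ y p ⊆ J \ Cut := by
      intro p' hp'
      have hd : dist p' y ≤ 25 * s := (dist_le_of_mem_segment hp').trans (by rw [dist_comm]; exact hp25)
      obtain ⟨hJ', hY'⟩ := hpt p' (by linarith)
      refine hoff p' hJ' hY' fun k hk => ?_
      have h1 := mem_ball.1 (hNball k hk)
      have h2 := hwin k
      linarith [dist_triangle y p' (P k), dist_comm y p']
    exact hjoinE p ((JoinedIn.of_segment_subset hseg).symm.trans hy)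

end Summit.CriticalPhenomena.SAWScalingLimit.Theorems.ObservableToSLE.TypeLadder

end
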